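import Summits.AtomisticToContinuum.Crystallization.Theorems.ChartedZeroExcessLayeredLatticeLiouvilleYOA

/-!
# Part YO «LoadPath» (lens-2 g68): the existence leaf (QE) from a tube reference, (XR) ∧ (X1) ∧ (X2ᴸ) — part 2 of 2 (sequel of `…ChartedZeroExcessLayeredLatticeLiouvilleYOA`)

Split for the 400-line cap by the landing lane (hand-2 g33); the module docstring of part 1 (`…ChartedZeroExcessLayeredLatticeLiouvilleYOA`) describes the whole node.  Same namespace; all FQNs unchanged.
(D1) of critic row 1250 APPLIED in these bytes (lens-2 g68 re-instance, seat sha16 407fc792): the dial instance carries `lam := 7/2000` (half the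
Hessian floor `λ_T ≥ 7/1000`); part 1 (`…YOA`, landed p852275 from the pre-(D1) seat bytes 0df29d89) differs from the re-instanced seat file only in two
module-docstring lines that still quote `lam = 7/1000` — the declarations of part 1 are byte-identical.
0 sorry; standard axioms.
-/

noncomputable section
open scoped BigOperators Classical
open MeasureTheory Set Metric Filter Topology
open Summit.AtomisticToContinuum.Crystallization.Theorems.ChartedPlanarOrderRigidityDoor (E3 eStar atomsIn IsEStarGSC siteEnergy VisibleGap PertRegime)
open Summit.AtomisticToContinuum.Crystallization.Theorems.ChartedPlanarOrderDensityDichotomy (μS IsSep nK nK_nonneg)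
open Summit.AtomisticToContinuum.Crystallization.Theorems.ChartedPlanarOrderCleanScaleP (IsCleanP IsDoorSetP)
open Summit.AtomisticToContinuum.Crystallization.Theorems.ChartedPlanarOrderMesoCut (LayeredHom EnvClose)
open Summit.AtomisticToContinuum.Crystallization.Theorems.ChartedPlanarOrderDoorLayered (atomsIn_subset sq_le_finsum_mem PeriodicBulkGapDoor)
open Summit.AtomisticToContinuum.Crystallization.Theorems.ChartedPlanarOrderDoorLayeredOsc (IsTwoShellAffineGood)
open Literature.MathematicalPhysics.StatisticalMechanics (card_le_of_separated_of_dist_le lennardJones interactionEnergy)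

namespace Summit.AtomisticToContinuum.Crystallization.Theorems.ChartedZeroExcessLayeredLatticeLiouville

/-! ### YO-3  The reference predicate and the three pieces (XR) / (X1) / (X2ᴸ) (typed; binders of (QE) verbatim) -/

section LoadPath

/-- **`IsTubeReference ϑ₀ ϑ dm Rg sb dI dB X H xf y₀`** — `y₀` is a REFERENCE FILLING for the core `xf` in the frozen field of `X` with chart lattice `H`:
`y₀` is `ϑ₀`-tame at every site w.r.t. `X ∪ range y₀`, and EVERY MEMBER `z` of its bond tube `bondTube X Rg sb dI dB y₀` is injective, off `X`, matched to
`xf` within `dm` sitewise, and `ϑ`-tame at every site w.r.t. `X ∪ range z` — the conclusion of (QE) except criticality, for the whole tube at once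
(KINEMATIC: budget `ϑ ≳ ϑ₀ + max(sb, dI)` with `Rg ≥ 4 + 2·dB`). [this file, g68] -/
def IsTubeReference (ϑ₀ ϑ dm Rg sb dI dB : ℝ) (X H : Set E3) {n : ℕ} (xf y₀ : Fin n → E3) : Prop :=
  (∀ i, IsTameStar ϑ₀ (X ∪ Set.range y₀) H (y₀ i)) ∧
    ∀ z ∈ bondTube X Rg sb dI dB y₀, Function.Injective z ∧ Disjoint (Set.range z) X ∧ (∀ i, dist (xf i) (z i) ≤ dm) ∧
      ∀ i, IsTameStar ϑ (X ∪ Set.range z) H (z i)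

/-- ★★ **(XR) «TubeReferenceP ϑc ϑ ϑp r q rsh ρ rm dm ϑ₀ Rg sb dI dB aHi Λ θ s» — A TUBE REFERENCE EXISTS.**  Under the binders of (QE) verbatim (θ-good
`aHi`-door set with summable pair sums, equilibrium chart, container `K ⊆ S ∩ B̄(x₀, q)`, `ϑp`-mild `rm`-core, `ϑc`-cool moat `moatIn S K r (r + rsh)`,
injective enumeration `xf` of the `ρ`-core): there is a reference filling `y₀` with `IsTubeReference ϑ₀ ϑ dm Rg sb dI dB (S ∖ core) (LayeredHom L w) xf y₀`.
KINEMATIC · ATTACKABLE (the chart-lattice filling bent along the cold collar's local frames and fitted to it: frame step (K1) of part YF; tameness of tube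
members is bookkeeping of `sb`/`dI` against the `4`-stars) · SIDEWAYS-WEAKER than (QE) (no equation is solved).
Why it might fail: REGISTRY SLIP — two patches of the collar registered to `H`-images differing by a non-lattice vector, so that no filling is tame at both;
then (QE) fails identically (the slip kills every tame filling), i.e. (XR) is at most (QE)-hard on this axis; budget failure `ϑ₀ + max(sb, dI) > ϑ` is a dial
error, not a refutation.
Sources: part YF ((K1) frame step); part YI ((QE), why-it-might-fail «registry slip»); CRITIC-LEDGER row 1237 (T1). [this file, g68] -/
def TubeReferenceP (ϑc ϑ ϑp r q rsh ρ rm dm ϑ₀ Rg sb dI dB aHi Λ θ s : ℝ) : Prop :=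
  ∀ δ : ℝ, 0 < δ → ∀ a : ℝ, 0 < a →
    ∀ S : Set E3, IsDoorSetP aHi δ S → (∀ z : E3, Summable fun y : S => lennardJones (dist z (y : E3))) →
      (∀ p ∈ S, IsTwoShellAffineGood θ S p) →
        ∀ (L : E3 ≃L[ℝ] E3) (w : ℤ → E3), IsEquilChart a s Λ L w →
          ∀ (x₀ : E3) (K : Set E3), K ⊆ S → (∀ k ∈ K, dist k x₀ ≤ q) →
            IsTameOn ϑp S (LayeredHom (L : E3 →L[ℝ] E3) w) (coreOf S K rm) →
              IsTameOn ϑc S (LayeredHom (L : E3 →L[ℝ] E3) w) (moatIn S K r (r + rsh)) →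
                ∀ (n : ℕ) (xf : Fin n → E3), Function.Injective xf → Set.range xf = coreOf S K ρ →
                  ∃ y₀ : Fin n → E3, IsTubeReference ϑ₀ ϑ dm Rg sb dI dB (S \ coreOf S K ρ) (LayeredHom (L : E3 →L[ℝ] E3) w) xf y₀

/-- ★★★ **(X1) «TubeConvexityP … lam …» — FIRST-ORDER STRONG CONVEXITY OF THE CLAMPED ENERGY ON THE BOND TUBE.**  Under the binders of (QE) verbatim and
for every tube reference `y₀`: at every member `z` of `bondTube (S ∖ core) Rg sb dI dB y₀` the clamped energy is differentiable with derivative `φ`, and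
`clampedEnergy z + φ (z' − z) + lam·Σᵢ dist(z i, z' i)² ≤ clampedEnergy z'` for every member `z'`.  Equivalent (for `C²` energies) to a uniform HARMONIC
FLOOR `D²(clampedEnergy) ≥ 2·lam` along every segment of the (convex) tube; it carries the RIGIDITY content (two tube-critical fillings coincide,
`eq_of_hasFDerivAt_zero_of_strongConvexOn`) and the CONTINUITY MODULUS of the march.  CERT-type · INSTRUMENTABLE «NearBorn-T» (smallest clamped-Hessian
eigenvalue over sampled TUBE MEMBERS — bond deviation up to `sb` about the reference, interface displacement up to `dI`, bulk displacement up to `dB` —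
NOT the NearBorn cell of rows 1229/1233, which samples AT the reference) · SIDEWAYS w.r.t. (QE).  Crude budget: Born drift `≈ 21·sb` relative (`≈ 16 %` at
`sb = 3/400`) against the NearBorn PASS mark `λ_min(reference) ≥ 0.0139` of rows 1229/1233 (census pending) and the tube PASS mark `λ_T ≥ 7/1000` of row 1237;
NOTE `lam = λ_T/2` — the first-order modulus with weight `Σᵢ dist²` is HALF the `ℓ²`-Hessian floor (row 1250 (D1)), so the instance carries `lam = 7/2000`.
Why it might fail: a fat tube (`sb ≳ 2 %`: second-shell stiffness drift `21·sb·2 ≫ λ_min`), under-coordinated INTERFACE stars whose clamped stiffness is below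
the bulk Dirichlet floor, or soft near-rigid modes of the deep core if the interface pin `dI` is too loose relative to `dB`; decided by NearBorn-T, repaired by
the radii.
Sources: part YI ((QC) and its why-it-might-fail); part YL/YM ((QH); NearBorn PASS marks of rows 1229/1233 `λ_min(y) ≥ 0.0139 / 0.0145`); Wallace, Thermodynamics of
Crystals (1972) (Born stability); E–Ming, Arch. Ration. Mech. Anal. 183 (2007) 241 §2; CRITIC-LEDGER row 1237 (F1). [this file, g68] -/
def TubeConvexityP (ϑc ϑ ϑp r q rsh ρ rm dm ϑ₀ Rg sb dI dB lam aHi Λ θ s : ℝ) : Prop :=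
  ∀ δ : ℝ, 0 < δ → ∀ a : ℝ, 0 < a →
    ∀ S : Set E3, IsDoorSetP aHi δ S → (∀ z : E3, Summable fun y : S => lennardJones (dist z (y : E3))) →
      (∀ p ∈ S, IsTwoShellAffineGood θ S p) →
        ∀ (L : E3 ≃L[ℝ] E3) (w : ℤ → E3), IsEquilChart a s Λ L w →
          ∀ (x₀ : E3) (K : Set E3), K ⊆ S → (∀ k ∈ K, dist k x₀ ≤ q) →
            IsTameOn ϑp S (LayeredHom (L : E3 →L[ℝ] E3) w) (coreOf S K rm) →
              IsTameOn ϑc S (LayeredHom (L : E3 →L[ℝ] E3) w) (moatIn S K r (r + rsh)) →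
                ∀ (n : ℕ) (xf : Fin n → E3), Function.Injective xf → Set.range xf = coreOf S K ρ →
                  ∀ y₀ : Fin n → E3, IsTubeReference ϑ₀ ϑ dm Rg sb dI dB (S \ coreOf S K ρ) (LayeredHom (L : E3 →L[ℝ] E3) w) xf y₀ →
                    ∀ z ∈ bondTube (S \ coreOf S K ρ) Rg sb dI dB y₀, ∃ φ : (Fin n → E3) →L[ℝ] ℝ,
                      HasFDerivAt (fun z : Fin n → E3 => clampedEnergy (S \ coreOf S K ρ) z) φ z ∧
                        ∀ z' ∈ bondTube (S \ coreOf S K ρ) Rg sb dI dB y₀,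
                          clampedEnergy (S \ coreOf S K ρ) z + φ (z' - z) + lam * ∑ i, dist (z i) (z' i) ^ 2 ≤
                            clampedEnergy (S \ coreOf S K ρ) z'

/-- ★★★ **(X2ᴸ) «LoadedTubeAprioriP … sb₁ dI₁ dB₁ …» — A-PRIORI CONFINEMENT OF LOADED SOLUTIONS TO THE INNER TUBE.**  Under the binders of (QE) verbatim,
for every tube reference `y₀` with `φ₀ := D(clampedEnergy)(y₀)` (its residual load): every member `z` of the OUTER tube `bondTube (S ∖ core) Rg sb dI dB y₀`
solving the LOADED equilibrium equations `D(clampedEnergy)(z) = (1 − t)·φ₀` for some `t ∈ [0, 1]` lies in the INNER tube `bondTube (S ∖ core) Rg sb₁ dI₁ dB₁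
y₀`.  A LOCATION statement about solutions that are GIVEN — never an existence statement; with (X1) the loaded solution is unique in the tube for each `t`
and this is the a-priori estimate of the continuation method.  ANALYTIC · HEAVY · UNDECIDED · LINEARISABLE: `z − y₀ = −t·H̄(z)⁻¹ φ₀` with `H̄` the
segment-averaged Hessian (a member of the tube's stiffness class), so a sufficient LINEAR form is a MAX-NORM (`W^{1,∞}`-type) bound for the clamped lattice
Green's operator of that class in divergence form (`dI₁ ≥ C_disp·‖φ₀‖`, `sb₁ ≥ C_strain·‖φ₀‖`, `‖φ₀‖ ≲ c·ϑc` from the cold collar) — the next node.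
INSTRUMENTABLE «FillTame-T»: relax the sampled cores under the loads `(1 − t)·φ₀`, `t ∈ {1/4, 1/2, 3/4, 1}`, from the fitted chart filling; report
`max` bond deviation / interface displacement / bulk displacement against `(sb₁, dI₁, dB₁)` and the linear-response constants `C_disp`, `C_strain`.
Why it might fail: `C_disp·ϑc > dI₁` at the sampled moat temperature (g67 estimate `d∞ ≈ 8·ϑc`: `ϑc = 1/2000 ↦ 0.004` against `dI₁ = 1/200`; repair: the FREE
moat dial `ϑc ↓`, `CoolMoatSlavedFillingP.of_moat_le`), logarithmic growth of the max-norm Green's bound in the core radius, or — if (X1) fails — a second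
loaded critical point near the rim of the outer tube.
Sources: E–Ming 2007 (a-priori estimates for the Cauchy–Born/atomistic equilibrium by linearised stability); Ortner–Theil, Arch. Ration. Mech. Anal. 207
(2013) 1025; Ehrlacher–Ortner–Shapeev, Arch. Ration. Mech. Anal. 222 (2016) 1217 (decay/regularity of clamped far fields); Braun–Schmidt, arXiv:1604.00197
(discrete regularity near lattice ground states); CRITIC-LEDGER row 1237 (F2), (F3). [this file, g68] -/
def LoadedTubeAprioriP (ϑc ϑ ϑp r q rsh ρ rm dm ϑ₀ Rg sb dI dB sb₁ dI₁ dB₁ aHi Λ θ s : ℝ) : Prop :=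
  ∀ δ : ℝ, 0 < δ → ∀ a : ℝ, 0 < a →
    ∀ S : Set E3, IsDoorSetP aHi δ S → (∀ z : E3, Summable fun y : S => lennardJones (dist z (y : E3))) →
      (∀ p ∈ S, IsTwoShellAffineGood θ S p) →
        ∀ (L : E3 ≃L[ℝ] E3) (w : ℤ → E3), IsEquilChart a s Λ L w →
          ∀ (x₀ : E3) (K : Set E3), K ⊆ S → (∀ k ∈ K, dist k x₀ ≤ q) →
            IsTameOn ϑp S (LayeredHom (L : E3 →L[ℝ] E3) w) (coreOf S K rm) →
              IsTameOn ϑc S (LayeredHom (L : E3 →L[ℝ] E3) w) (moatIn S K r (r + rsh)) →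
                ∀ (n : ℕ) (xf : Fin n → E3), Function.Injective xf → Set.range xf = coreOf S K ρ →
                  ∀ y₀ : Fin n → E3, IsTubeReference ϑ₀ ϑ dm Rg sb dI dB (S \ coreOf S K ρ) (LayeredHom (L : E3 →L[ℝ] E3) w) xf y₀ →
                    ∀ φ₀ : (Fin n → E3) →L[ℝ] ℝ, HasFDerivAt (fun z : Fin n → E3 => clampedEnergy (S \ coreOf S K ρ) z) φ₀ y₀ →
                      ∀ t : ℝ, 0 ≤ t → t ≤ 1 → ∀ z ∈ bondTube (S \ coreOf S K ρ) Rg sb dI dB y₀,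
                        HasFDerivAt (fun z : Fin n → E3 => clampedEnergy (S \ coreOf S K ρ) z) ((1 - t) • φ₀) z →
                          z ∈ bondTube (S \ coreOf S K ρ) Rg sb₁ dI₁ dB₁ y₀

/-! ### YO-4  THE GLUE (PROVED): (QE) ⟸ (XR) ∧ (X1) ∧ (X2ᴸ); dials; the tube-docket slot; the proposed dial instance -/

/-- ★★★ **THE LOAD-PATH GLUE (PROVED): (XR) ∧ (X1)(lam > 0) ∧ (X2ᴸ)(0 ≤ sb₁ < sb, 0 ≤ dI₁ < dI, 0 ≤ dB₁ < dB) ⇒ (QE)(ϑc, ϑ, ϑp, dm).**  Fix the data and the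
enumerated core; (XR) gives the reference `y₀` and its tube `T := bondTube (S ∖ core) Rg sb dI dB y₀` (convex, compact) with inner tube `T₁`; (X1) gives
first-order strong convexity of the clamped energy on `T` (and its derivative `φ₀` at `y₀`); (X2ᴸ) confines the loaded critical points to `T₁`; the engine
`exists_hasFDerivAt_zero_of_loadPath` with `gap := min((sb − sb₁)/4, (dI − dI₁)/2, (dB − dB₁)/2)` and weight `Σᵢ dist²` produces a clamped-critical `z ∈ T₁`,
and (XR) certifies that `z` is injective, off the exterior, matched within `dm` and `ϑ`-tame w.r.t. the glued configuration. [this file, g68] -/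
theorem coolMoatSlavedFillingP_of_loadPath {ϑc ϑ ϑp r q rsh ρ rm dm ϑ₀ Rg sb dI dB sb₁ dI₁ dB₁ lam aHi Λ θ s : ℝ}
    (hlam : 0 < lam) (hsb : sb₁ < sb) (hdI : dI₁ < dI) (hdB : dB₁ < dB) (hsb₀ : 0 ≤ sb₁) (hdI₀ : 0 ≤ dI₁) (hdB₀ : 0 ≤ dB₁)
    (hR : TubeReferenceP ϑc ϑ ϑp r q rsh ρ rm dm ϑ₀ Rg sb dI dB aHi Λ θ s)
    (hC : TubeConvexityP ϑc ϑ ϑp r q rsh ρ rm dm ϑ₀ Rg sb dI dB lam aHi Λ θ s)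
    (hA : LoadedTubeAprioriP ϑc ϑ ϑp r q rsh ρ rm dm ϑ₀ Rg sb dI dB sb₁ dI₁ dB₁ aHi Λ θ s) :
    CoolMoatSlavedFillingP ϑc ϑ ϑp r q rsh ρ rm dm aHi Λ θ s := by
  intro δ hδ a ha S hS hsum hgood L w hLw x₀ K hKS hKq hmild hcool n xf hxf hrange
  obtain ⟨y₀, hy₀⟩ := hR δ hδ a ha S hS hsum hgood L w hLw x₀ K hKS hKq hmild hcool n xf hxf hrange
  have hSC := hC δ hδ a ha S hS hsum hgood L w hLw x₀ K hKS hKq hmild hcool n xf hxf hrange y₀ hy₀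
  have hT₁T : bondTube (S \ coreOf S K ρ) Rg sb₁ dI₁ dB₁ y₀ ⊆ bondTube (S \ coreOf S K ρ) Rg sb dI dB y₀ :=
    bondTube_mono hsb.le hdI.le hdB.le
  have hy₀T₁ : y₀ ∈ bondTube (S \ coreOf S K ρ) Rg sb₁ dI₁ dB₁ y₀ := self_mem_bondTube hsb₀ hdI₀ hdB₀
  obtain ⟨φ₀, hφ₀, -⟩ := hSC y₀ (hT₁T hy₀T₁)
  have hAp := hA δ hδ a ha S hS hsum hgood L w hLw x₀ K hKS hKq hmild hcool n xf hxf hrange y₀ hy₀ φ₀ hφ₀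
  have hgap : 0 < min ((sb - sb₁) / 4) (min ((dI - dI₁) / 2) ((dB - dB₁) / 2)) :=
    lt_min (by linarith) (lt_min (by linarith) (by linarith))
  have hg1 : min ((sb - sb₁) / 4) (min ((dI - dI₁) / 2) ((dB - dB₁) / 2)) ≤ (sb - sb₁) / 4 := min_le_left _ _
  have hg2 : min ((sb - sb₁) / 4) (min ((dI - dI₁) / 2) ((dB - dB₁) / 2)) ≤ (dI - dI₁) / 2 := (min_le_right _ _).trans (min_le_left _ _)
  have hg3 : min ((sb - sb₁) / 4) (min ((dI - dI₁) / 2) ((dB - dB₁) / 2)) ≤ (dB - dB₁) / 2 := (min_le_right _ _).trans (min_le_right _ _)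
  obtain ⟨z, hz₁, hz⟩ := exists_hasFDerivAt_zero_of_loadPath
    (E := fun z : Fin n → E3 => clampedEnergy (S \ coreOf S K ρ) z) (D := fun z z' : Fin n → E3 => ∑ i, dist (z i) (z' i) ^ 2)
    (isCompact_bondTube (hdB₀.trans hdB.le)) convex_bondTube hT₁T hy₀T₁ hgap
    (fun z hz z' hz' => bondTube_margin (by linarith) (by linarith) (by linarith) hz hz') hlam
    (fun z z' => norm_sub_sq_le_sum_dist_sq z z') hφ₀ hSC hAp
  obtain ⟨hinj, hdisj, hnear, htame⟩ := hy₀.2 z (hT₁T hz₁)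
  exact ⟨z, hinj, hdisj, hnear, hz, htame⟩

/-- **DIAL (PROVED): (X1) is WEAKER at a smaller modulus** (`lam' ≤ lam`). [this file, g68] -/
theorem TubeConvexityP.of_le {ϑc ϑ ϑp r q rsh ρ rm dm ϑ₀ Rg sb dI dB lam lam' aHi Λ θ s : ℝ} (h : lam' ≤ lam)
    (hC : TubeConvexityP ϑc ϑ ϑp r q rsh ρ rm dm ϑ₀ Rg sb dI dB lam aHi Λ θ s) :
    TubeConvexityP ϑc ϑ ϑp r q rsh ρ rm dm ϑ₀ Rg sb dI dB lam' aHi Λ θ s := by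
  intro δ hδ a ha S hS hsum hgood L w hLw x₀ K hKS hKq hmild hcool n xf hxf hrange y₀ hy₀ z hz
  obtain ⟨φ, hφ, hsc⟩ := hC δ hδ a ha S hS hsum hgood L w hLw x₀ K hKS hKq hmild hcool n xf hxf hrange y₀ hy₀ z hz
  refine ⟨φ, hφ, fun z' hz' => ?_⟩
  have key := hsc z' hz'
  have hnn : 0 ≤ ∑ i, dist (z i) (z' i) ^ 2 := Finset.sum_nonneg fun i _ => sq_nonneg _
  nlinarith [mul_le_mul_of_nonneg_right h hnn]

/-- **DIAL (PROVED): (X2ᴸ) is WEAKER for larger inner radii** (`sb₁ ≤ sb₁'`, `dI₁ ≤ dI₁'`, `dB₁ ≤ dB₁'`). [this file, g68] -/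
theorem LoadedTubeAprioriP.of_inner_le {ϑc ϑ ϑp r q rsh ρ rm dm ϑ₀ Rg sb dI dB sb₁ dI₁ dB₁ sb₁' dI₁' dB₁' aHi Λ θ s : ℝ}
    (hs : sb₁ ≤ sb₁') (hI : dI₁ ≤ dI₁') (hB : dB₁ ≤ dB₁')
    (hA : LoadedTubeAprioriP ϑc ϑ ϑp r q rsh ρ rm dm ϑ₀ Rg sb dI dB sb₁ dI₁ dB₁ aHi Λ θ s) :
    LoadedTubeAprioriP ϑc ϑ ϑp r q rsh ρ rm dm ϑ₀ Rg sb dI dB sb₁' dI₁' dB₁' aHi Λ θ s :=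
  fun δ hδ a ha S hS hsum hgood L w hLw x₀ K hKS hKq hmild hcool n xf hxf hrange y₀ hy₀ φ₀ hφ₀ t ht0 ht1 z hz hcrit =>
    bondTube_mono hs hI hB (hA δ hδ a ha S hS hsum hgood L w hLw x₀ K hKS hKq hmild hcool n xf hxf hrange y₀ hy₀ φ₀ hφ₀ t ht0 ht1 z hz hcrit)

/-- **DIAL (PROVED): all three pieces are WEAKER at a colder moat** (`ϑm ≤ ϑc`) — the free dial of the existence leaf passes to the pieces. [this file, g68] -/
theorem TubeReferenceP.of_moat_le {ϑm ϑc ϑ ϑp r q rsh ρ rm dm ϑ₀ Rg sb dI dB aHi Λ θ s : ℝ} (h : ϑm ≤ ϑc)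
    (hR : TubeReferenceP ϑc ϑ ϑp r q rsh ρ rm dm ϑ₀ Rg sb dI dB aHi Λ θ s) : TubeReferenceP ϑm ϑ ϑp r q rsh ρ rm dm ϑ₀ Rg sb dI dB aHi Λ θ s :=
  fun δ hδ a ha S hS hsum hgood L w hLw x₀ K hKS hKq hmild hcool n xf hxf hrange =>
    hR δ hδ a ha S hS hsum hgood L w hLw x₀ K hKS hKq hmild (IsTameOn.mono h Subset.rfl hcool) n xf hxf hrange

/-- ★ **(X1) ⇒ TUBE RIGIDITY (PROVED)**: under (X1)(lam > 0), two clamped-critical members of the bond tube of a reference COINCIDE — the uniqueness content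
of the convexity piece (compare (QU) `TubeCriticalUniquenessP` of part YL, a sitewise tube about the tame END). [this file, g68] -/
theorem tube_critical_unique_of_convexity {ϑc ϑ ϑp r q rsh ρ rm dm ϑ₀ Rg sb dI dB lam aHi Λ θ s : ℝ} (hlam : 0 < lam)
    (hC : TubeConvexityP ϑc ϑ ϑp r q rsh ρ rm dm ϑ₀ Rg sb dI dB lam aHi Λ θ s) :
    ∀ δ : ℝ, 0 < δ → ∀ a : ℝ, 0 < a →
      ∀ S : Set E3, IsDoorSetP aHi δ S → (∀ z : E3, Summable fun y : S => lennardJones (dist z (y : E3))) →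
        (∀ p ∈ S, IsTwoShellAffineGood θ S p) →
          ∀ (L : E3 ≃L[ℝ] E3) (w : ℤ → E3), IsEquilChart a s Λ L w →
            ∀ (x₀ : E3) (K : Set E3), K ⊆ S → (∀ k ∈ K, dist k x₀ ≤ q) →
              IsTameOn ϑp S (LayeredHom (L : E3 →L[ℝ] E3) w) (coreOf S K rm) →
                IsTameOn ϑc S (LayeredHom (L : E3 →L[ℝ] E3) w) (moatIn S K r (r + rsh)) →
                  ∀ (n : ℕ) (xf : Fin n → E3), Function.Injective xf → Set.range xf = coreOf S K ρ →
                    ∀ y₀ : Fin n → E3, IsTubeReference ϑ₀ ϑ dm Rg sb dI dB (S \ coreOf S K ρ) (LayeredHom (L : E3 →L[ℝ] E3) w) xf y₀ →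
                      ∀ z ∈ bondTube (S \ coreOf S K ρ) Rg sb dI dB y₀, ∀ z' ∈ bondTube (S \ coreOf S K ρ) Rg sb dI dB y₀,
                        HasFDerivAt (fun z : Fin n → E3 => clampedEnergy (S \ coreOf S K ρ) z) (0 : (Fin n → E3) →L[ℝ] ℝ) z →
                          HasFDerivAt (fun z : Fin n → E3 => clampedEnergy (S \ coreOf S K ρ) z) (0 : (Fin n → E3) →L[ℝ] ℝ) z' → z = z' := by
  intro δ hδ a ha S hS hsum hgood L w hLw x₀ K hKS hKq hmild hcool n xf hxf hrange y₀ hy₀ z hz z' hz' h h'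
  exact eq_of_hasFDerivAt_zero_of_strongConvexOn (D := fun z z' : Fin n → E3 => ∑ i, dist (z i) (z' i) ^ 2) hlam
    (fun z z' => norm_sub_sq_le_sum_dist_sq z z') (hC δ hδ a ha S hS hsum hgood L w hLw x₀ K hKS hKq hmild hcool n xf hxf hrange y₀ hy₀) hz hz' h h'

/-- ★★ **THE TUBE-DOCKET SLOT (PROVED)**: the three pieces at the docket geometry `(r, q, rsh, ρ, rm) = (8, 4, 12, 16, 16)`, `(aHi, Λ, θ, s) = (1, 2, 1/16, 1/50)`,
matching radius `dm = 1/2`, give EXACTLY the existence leaf `CoolMoatSlavedFillingP ϑm ϑf ϑp 8 4 12 16 16 (1/2) 1 2 (1/16) (1/50)` that `MildTubeDocket ϑm ra ϑp ϑf rb`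
(part YM) consumes — with the tube radii, the reference tameness `ϑ₀` and the modulus `lam` FREE. [this file, g68] -/
theorem coolMoatSlavedFillingP_tubeSlot_of_loadPath {ϑm ϑf ϑp ϑ₀ Rg sb dI dB sb₁ dI₁ dB₁ lam : ℝ}
    (hlam : 0 < lam) (hsb : sb₁ < sb) (hdI : dI₁ < dI) (hdB : dB₁ < dB) (hsb₀ : 0 ≤ sb₁) (hdI₀ : 0 ≤ dI₁) (hdB₀ : 0 ≤ dB₁)
    (hR : TubeReferenceP ϑm ϑf ϑp 8 4 12 16 16 (1 / 2) ϑ₀ Rg sb dI dB 1 2 (1 / 16) (1 / 50))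
    (hC : TubeConvexityP ϑm ϑf ϑp 8 4 12 16 16 (1 / 2) ϑ₀ Rg sb dI dB lam 1 2 (1 / 16) (1 / 50))
    (hA : LoadedTubeAprioriP ϑm ϑf ϑp 8 4 12 16 16 (1 / 2) ϑ₀ Rg sb dI dB sb₁ dI₁ dB₁ 1 2 (1 / 16) (1 / 50)) :
    CoolMoatSlavedFillingP ϑm ϑf ϑp 8 4 12 16 16 (1 / 2) 1 2 (1 / 16) (1 / 50) :=
  coolMoatSlavedFillingP_of_loadPath hlam hsb hdI hdB hsb₀ hdI₀ hdB₀ hR hC hA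

/-- ★ **THE PROPOSED DIAL INSTANCE (PROVED)**: moat temperature `ϑm = 1/2000`, filling tameness `ϑf = 1/100`, mild amplitude `ϑp = 1/10`, reference tameness
`ϑ₀ = 1/400`, bond range `Rg = 5 ≥ 4 + 2·dB`, outer radii `(sb, dI, dB) = (3/400, 3/400, 3/10)` (tameness budget `ϑ₀ + max(sb, dI) = 1/100 = ϑf`), inner
radii `(sb₁, dI₁, dB₁) = (1/200, 1/200, 3/20)` (linear response `≈ 8·ϑm = 1/250 < 1/200`), modulus `lam = 7/2000` (HALF the NearBorn-T PASS mark `λ_T ≥ 7/1000`)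
⇒ the existence leaf of the tube docket at `(1/2000, 1/100, 1/10)`. [this file, g68] -/
theorem loadPath_dial_instance
    (hR : TubeReferenceP (1 / 2000) (1 / 100) (1 / 10) 8 4 12 16 16 (1 / 2) (1 / 400) 5 (3 / 400) (3 / 400) (3 / 10) 1 2 (1 / 16) (1 / 50))
    (hC : TubeConvexityP (1 / 2000) (1 / 100) (1 / 10) 8 4 12 16 16 (1 / 2) (1 / 400) 5 (3 / 400) (3 / 400) (3 / 10) (7 / 2000) 1 2 (1 / 16) (1 / 50))
    (hA : LoadedTubeAprioriP (1 / 2000) (1 / 100) (1 / 10) 8 4 12 16 16 (1 / 2) (1 / 400) 5 (3 / 400) (3 / 400) (3 / 10)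
      (1 / 200) (1 / 200) (3 / 20) 1 2 (1 / 16) (1 / 50)) :
    CoolMoatSlavedFillingP (1 / 2000) (1 / 100) (1 / 10) 8 4 12 16 16 (1 / 2) 1 2 (1 / 16) (1 / 50) :=
  coolMoatSlavedFillingP_tubeSlot_of_loadPath (by norm_num) (by norm_num) (by norm_num) (by norm_num) (by norm_num) (by norm_num) (by norm_num) hR hC hA

end LoadPath

end Summit.AtomisticToContinuum.Crystallization.Theorems.ChartedZeroExcessLayeredLatticeLiouville

end
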